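import Mathlib
import Summits.NavierStokesRegularity.FluidComputer.BeltramiHostLinearisation
import HarnessLib

/-!
# The Beltrami sextuplet of the ABC host: a six-parameter family of exact `−ν` directions

HONEST FRAMING (cell `ns-blowup`, seat `ns-blowup-instab`, human ruling D-0035): nothing here is
a claim about Navier–Stokes blow-up. WHAT THIS IS NOT: not a statement about the marginal tower
N1*; it completes the kernel form of refuter KILLSHEET §XIII.0 («BELTRAMI SEXTUPLET … real
dimension 6: the ABC family's three amplitudes and three phases … −ν is an EXACT eigenvalue of L₀
of multiplicity ≥ 6 with DELOCALISED steady eigenfunctions») for the MODEL host, the part that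
`BeltramiHostLinearisation` (pointwise identity for ONE strong Beltrami direction) left as
bookkeeping.

The family. For amplitudes `(A, B, C)` and «phases» `(A', B', C')` let
`S(x) = abc A B C (x) + abc A' B' C' (x + p)`, `p = (π/2, π/2, π/2)` — the second summand is the
quarter-period translate `(A' cos x₂ − C' sin x₁, B' cos x₀ − A' sin x₂, C' cos x₁ − B' sin x₀)`
(`abc_translate_apply_*`), i.e. `S` runs over the real span of the six fields
`(sin x₂, cos x₂, 0), (cos x₂, −sin x₂, 0), (0, sin x₀, cos x₀), (0, cos x₀, −sin x₀),
(cos x₁, 0, sin x₁), (−sin x₁, 0, cos x₁)` = the `(+)`-helical `|k| = 1` shell.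

* §1 translates of Beltrami / divergence-free / smooth fields are such (`curl_translate`,
  `IsBeltrami.translate`, `isDivFree_translate`);
* §2 every member `S` is a smooth divergence-free strong Beltrami field with `λ̄ = 1`
  (`isBeltrami_sextuplet`, `contDiff_sextuplet`, `isDivFree_sextuplet`), hence (§3) an exact `−ν`
  direction of the linearised operator about ANY ABC host `U = abc A₀ B₀ C₀`:
  `−[(U·∇)S + (S·∇)U] + νΔS = −ν S − ∇(U·S)` (`linearisedNS_abc_sextuplet`, from
  `BeltramiHostLinearisation.linearisedNS_abc`), and `U + e^{−νt}S` solves the forced system exactly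
  (`isClassicalNSSolutionOn_abc_sextuplet`);
* §4 **the family is six-dimensional**: `S ≡ 0` forces `A = B = C = A' = B' = C' = 0`
  (`sextuplet_coeffs_eq_zero`, evaluation at `0` and at `(π/2)eⱼ`), i.e. the linear
  parametrisation `(A, …, C') ↦ S` is injective (`sextuplet_injective`).

So, modulo gradients (Leray projection), `−ν` has at least a six-dimensional eigenspace of
delocalised steady fields for every ABC host — none of them an X0 object (they decay). References:
V. I. Arnold (1965); Majda–Bertozzi (2002) §2.3.2 Example 2.8; cell file `KILLSHEET.md` §XIII.0.
-/

noncomputable section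

open Set Real InnerProductSpace
open scoped RealInnerProductSpace ContDiff Laplacian Topology

namespace Summit.NavierStokesRegularity.FluidComputer.BeltramiSextuplet

open Literature.Analysis.FluidPDE Literature.Analysis.FluidPDE.ABC BeltramiHostLinearisation

/-! ### §1 Translates -/

/-- `curl (v(· + c)) (x) = (curl v)(x + c)`. -/
theorem curl_translate (v : EuclideanSpace ℝ (Fin 3) → EuclideanSpace ℝ (Fin 3))
    (c x : EuclideanSpace ℝ (Fin 3)) :
    curl (fun y => v (y + c)) x = curl v (x + c) := by
  rw [curl_eq_curlCLM, curl_eq_curlCLM, fderiv_comp_add_right]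

/-- A translate of a Beltrami field is Beltrami with the translated coefficient. -/
theorem _root_.Literature.Analysis.FluidPDE.IsBeltrami.translate
    {v : EuclideanSpace ℝ (Fin 3) → EuclideanSpace ℝ (Fin 3)} {lam : EuclideanSpace ℝ (Fin 3) → ℝ}
    (hv : IsBeltrami v lam) (c : EuclideanSpace ℝ (Fin 3)) :
    IsBeltrami (fun y => v (y + c)) (fun y => lam (y + c)) := fun x => by
  rw [curl_translate, hv (x + c)]

/-- `div (v(· + c)) (x) = (div v)(x + c)`. -/
theorem divergence_translate (v : EuclideanSpace ℝ (Fin 3) → EuclideanSpace ℝ (Fin 3))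
    (c x : EuclideanSpace ℝ (Fin 3)) :
    VectorCalculus.divergence (fun y => v (y + c)) x = VectorCalculus.divergence v (x + c) := by
  simp only [VectorCalculus.divergence, fderiv_comp_add_right]

/-- A translate of a divergence-free field is divergence free. -/
theorem isDivFree_translate {v : EuclideanSpace ℝ (Fin 3) → EuclideanSpace ℝ (Fin 3)}
    (hv : VectorCalculus.IsDivFree v) (c : EuclideanSpace ℝ (Fin 3)) :
    VectorCalculus.IsDivFree (fun y => v (y + c)) := fun x => by
  rw [divergence_translate, hv (x + c)]

/-- A translate of a `Cⁿ` field is `Cⁿ`. -/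
theorem contDiff_translate {v : EuclideanSpace ℝ (Fin 3) → EuclideanSpace ℝ (Fin 3)} {n : WithTop ℕ∞}
    (hv : ContDiff ℝ n v) (c : EuclideanSpace ℝ (Fin 3)) : ContDiff ℝ n (fun y => v (y + c)) :=
  hv.comp (contDiff_id.add contDiff_const)

/-! ### §2 The sextuplet fields -/

section Family

variable (A B C A' B' C' : ℝ) (p : EuclideanSpace ℝ (Fin 3))

/-- Components of the quarter-period translate: `abc A' B' C' (x + p) 0 = A' cos x₂ − C' sin x₁`. -/
theorem abc_translate_apply_zero (hp : ∀ j, p j = π / 2) (x : EuclideanSpace ℝ (Fin 3)) :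
    abc A' B' C' (x + p) 0 = A' * cos (x 2) - C' * sin (x 1) := by
  simp only [abc_apply_zero, PiLp.add_apply, hp, sin_add_pi_div_two, cos_add_pi_div_two]
  ring

/-- Components of the quarter-period translate: `abc A' B' C' (x + p) 1 = B' cos x₀ − A' sin x₂`. -/
theorem abc_translate_apply_one (hp : ∀ j, p j = π / 2) (x : EuclideanSpace ℝ (Fin 3)) :
    abc A' B' C' (x + p) 1 = B' * cos (x 0) - A' * sin (x 2) := by
  simp only [abc_apply_one, PiLp.add_apply, hp, sin_add_pi_div_two, cos_add_pi_div_two]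
  ring

/-- Components of the quarter-period translate: `abc A' B' C' (x + p) 2 = C' cos x₁ − B' sin x₀`. -/
theorem abc_translate_apply_two (hp : ∀ j, p j = π / 2) (x : EuclideanSpace ℝ (Fin 3)) :
    abc A' B' C' (x + p) 2 = C' * cos (x 1) - B' * sin (x 0) := by
  simp only [abc_apply_two, PiLp.add_apply, hp, sin_add_pi_div_two, cos_add_pi_div_two]
  ring

/-- Every member of the family is a strong Beltrami field with `λ̄ = 1` (any shift `p`). -/
theorem isBeltrami_sextuplet :
    IsBeltrami (fun x => abc A B C x + abc A' B' C' (x + p)) fun _ => 1 :=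
  (isBeltrami_abc A B C).add ((isBeltrami_abc A' B' C').translate p) (differentiable_abc A B C)
    ((contDiff_translate (contDiff_abc A' B' C' (n := 1)) p).differentiable (by simp))

/-- Every member of the family is smooth. -/
theorem contDiff_sextuplet {n : WithTop ℕ∞} :
    ContDiff ℝ n (fun x => abc A B C x + abc A' B' C' (x + p)) :=
  (contDiff_abc A B C).add (contDiff_translate (contDiff_abc A' B' C') p)

/-- Every member of the family is divergence free. -/
theorem isDivFree_sextuplet :
    VectorCalculus.IsDivFree (fun x => abc A B C x + abc A' B' C' (x + p)) := fun x => by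
  rw [RingCorrector.divergence_add (differentiable_abc A B C x)
    (((contDiff_translate (contDiff_abc A' B' C' (n := 1)) p).differentiable (by simp)) x),
    isDivFree_abc A B C x, isDivFree_translate (isDivFree_abc A' B' C') p x, add_zero]

/-! ### §3 The exact `−ν` directions and the exact forced solutions -/

/-- **KILLSHEET XIII.0 for the whole family**: about the ABC host `U = abc A₀ B₀ C₀`, every member
`S` of the sextuplet family satisfies `−[(U·∇)S + (S·∇)U] + νΔS = −ν S − ∇(U·S)` at every point —
an exact `−ν` direction modulo gradients, for all amplitudes of host and direction. -/
theorem linearisedNS_abc_sextuplet (ν A₀ B₀ C₀ : ℝ) (x : EuclideanSpace ℝ (Fin 3)) :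
    -(convect (abc A₀ B₀ C₀) (fun y => abc A B C y + abc A' B' C' (y + p)) x +
        convect (fun y => abc A B C y + abc A' B' C' (y + p)) (abc A₀ B₀ C₀) x) +
      ν • (Δ (fun y => abc A B C y + abc A' B' C' (y + p))) x =
      (-ν) • (abc A B C x + abc A' B' C' (x + p)) -
        gradient (fun y => ⟪abc A₀ B₀ C₀ y, abc A B C y + abc A' B' C' (y + p)⟫) x :=
  linearisedNS_abc ν A₀ B₀ C₀ (isBeltrami_sextuplet A B C A' B' C' p)
    (contDiff_sextuplet A B C A' B' C' p) (isDivFree_sextuplet A B C A' B' C' p) x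

/-- **Exact forced solutions along the family**: `u(t) = U + e^{−νt} S`, `p = −½|u|²` solves the
Navier–Stokes system with force `νU` on `ℝ³ × ℝ` for every member `S` (an invariant six-parameter
family decaying onto the host; never an X0 object). -/
theorem isClassicalNSSolutionOn_abc_sextuplet (ν A₀ B₀ C₀ : ℝ) :
    IsClassicalNSSolutionOn univ ν (fun _ x => (ν * (1 : ℝ) ^ 2) • abc A₀ B₀ C₀ x)
      (fun t x => abc A₀ B₀ C₀ x +
        exp (-((1 : ℝ) ^ 2 * ν) * t) • (abc A B C x + abc A' B' C' (x + p)))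
      (fun t x => -(‖abc A₀ B₀ C₀ x +
        exp (-((1 : ℝ) ^ 2 * ν) * t) • (abc A B C x + abc A' B' C' (x + p))‖ ^ 2 / 2)) :=
  isClassicalNSSolutionOn_forcedHost ν (isBeltrami_abc A₀ B₀ C₀)
    (isBeltrami_sextuplet A B C A' B' C' p) (contDiff_abc A₀ B₀ C₀)
    (contDiff_sextuplet A B C A' B' C' p) (isDivFree_abc A₀ B₀ C₀)
    (isDivFree_sextuplet A B C A' B' C' p)

end Family

/-! ### §4 The family is six-dimensional -/

/-- `abc` is linear in its amplitudes: differences. -/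
theorem abc_sub (A₁ B₁ C₁ A₂ B₂ C₂ : ℝ) (x : EuclideanSpace ℝ (Fin 3)) :
    abc (A₁ - A₂) (B₁ - B₂) (C₁ - C₂) x = abc A₁ B₁ C₁ x - abc A₂ B₂ C₂ x := by
  ext i
  fin_cases i <;> simp <;> ring

/-- **Six real dimensions**: if `abc A B C (x) + abc A' B' C' (x + p) = 0` for all `x`
(`p = (π/2, π/2, π/2)`), then all six coefficients vanish — the three ABC amplitudes and the three
quarter-period «phases» are linearly independent directions. Proof: evaluate the three components at
`x = 0` and at `x = (π/2)eⱼ`, `j = 0, 1, 2`. -/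
theorem sextuplet_coeffs_eq_zero {A B C A' B' C' : ℝ} {p : EuclideanSpace ℝ (Fin 3)}
    (hp : ∀ j, p j = π / 2)
    (h : ∀ x : EuclideanSpace ℝ (Fin 3), abc A B C x + abc A' B' C' (x + p) = 0) :
    A = 0 ∧ B = 0 ∧ C = 0 ∧ A' = 0 ∧ B' = 0 ∧ C' = 0 := by
  have comp : ∀ (x : EuclideanSpace ℝ (Fin 3)) (i : Fin 3),
      abc A B C x i + abc A' B' C' (x + p) i = 0 := fun x i => by
    have := congrArg (fun v : EuclideanSpace ℝ (Fin 3) => v i) (h x)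
    simpa using this
  have c0 : ∀ x : EuclideanSpace ℝ (Fin 3),
      A * sin (x 2) + C * cos (x 1) + (A' * cos (x 2) - C' * sin (x 1)) = 0 := fun x => by
    have := comp x 0
    rwa [abc_apply_zero, abc_translate_apply_zero A' B' C' p hp] at this
  have c1 : ∀ x : EuclideanSpace ℝ (Fin 3),
      B * sin (x 0) + A * cos (x 2) + (B' * cos (x 0) - A' * sin (x 2)) = 0 := fun x => by
    have := comp x 1
    rwa [abc_apply_one, abc_translate_apply_one A' B' C' p hp] at this
  have c2 : ∀ x : EuclideanSpace ℝ (Fin 3),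
      C * sin (x 1) + B * cos (x 0) + (C' * cos (x 1) - B' * sin (x 0)) = 0 := fun x => by
    have := comp x 2
    rwa [abc_apply_two, abc_translate_apply_two A' B' C' p hp] at this
  have e00 := c0 0
  have e01 := c1 0
  have e02 := c2 0
  have e11 := c1 !₂[π / 2, 0, 0]
  have e12 := c2 !₂[π / 2, 0, 0]
  have e20 := c0 !₂[0, π / 2, 0]
  have e22 := c2 !₂[0, π / 2, 0]
  have e30 := c0 !₂[0, 0, π / 2]
  simp at e00 e01 e02 e11 e12 e20 e22 e30
  refine ⟨?_, ?_, ?_, ?_, ?_, ?_⟩ <;> linarith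

/-- **Injectivity of the parametrisation** `(A, B, C, A', B', C') ↦ abc A B C + abc A' B' C' (· + p)`:
two parameter sextuples giving the same field coincide. -/
theorem sextuplet_injective {A₁ B₁ C₁ A₁' B₁' C₁' A₂ B₂ C₂ A₂' B₂' C₂' : ℝ}
    {p : EuclideanSpace ℝ (Fin 3)} (hp : ∀ j, p j = π / 2)
    (h : ∀ x : EuclideanSpace ℝ (Fin 3),
      abc A₁ B₁ C₁ x + abc A₁' B₁' C₁' (x + p) = abc A₂ B₂ C₂ x + abc A₂' B₂' C₂' (x + p)) :
    A₁ = A₂ ∧ B₁ = B₂ ∧ C₁ = C₂ ∧ A₁' = A₂' ∧ B₁' = B₂' ∧ C₁' = C₂' := by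
  have hdiff : ∀ x : EuclideanSpace ℝ (Fin 3),
      abc (A₁ - A₂) (B₁ - B₂) (C₁ - C₂) x +
        abc (A₁' - A₂') (B₁' - B₂') (C₁' - C₂') (x + p) = 0 := fun x => by
    rw [abc_sub, abc_sub]
    have hx := h x
    calc abc A₁ B₁ C₁ x - abc A₂ B₂ C₂ x + (abc A₁' B₁' C₁' (x + p) - abc A₂' B₂' C₂' (x + p))
        = (abc A₁ B₁ C₁ x + abc A₁' B₁' C₁' (x + p)) -
            (abc A₂ B₂ C₂ x + abc A₂' B₂' C₂' (x + p)) := by abel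
      _ = 0 := sub_eq_zero.mpr hx
  obtain ⟨h1, h2, h3, h4, h5, h6⟩ := sextuplet_coeffs_eq_zero hp hdiff
  refine ⟨?_, ?_, ?_, ?_, ?_, ?_⟩ <;> linarith

end Summit.NavierStokesRegularity.FluidComputer.BeltramiSextuplet
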